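import Summits.HodgeConjecture.HodgeConjecture.Theorems.F0P3RelParityOfT5          -- ★ (F0P2-p02 (g9), p843477∕p843496): `relSharpGuardedOneMeasure_of_T5` (REL♯ ⟸ T5, one measure, kit-generic)
import Summits.HodgeConjecture.HodgeConjecture.Theorems.F0P3KitOfRecordLawsV8W     -- ★6 (w2) (this pen): `laws₈_kitOfRecordW_of₄` (+ (w1) `kitFamilyOfRecordW`, `isPinned_kitFamilyOfRecordW`, ★1 `kitOfRecordW`)
import HarnessLib

/-!
# Crux `H413` — closer ED. 38 «PK-ε», ★6 «REL♯-W» (w3): **REL♯ (one measure) AT THE W-KIT FAMILY OF RECORD, from the closer's FOURTEEN ROWS** — ★ `F0P3RelParityOfRecord` twin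

F0∕P2 ∕ P3 «U3-mult», cell `hodgecm-mathlib`, crux H413 (`stmt-HodgeConjecture-24833`); books row #162 REL♯ «(C4)»; RULING D53-pre PART A (4) ★6 (w3) as worded by the desk heir
F0P3-plan (g12) 22:28:34Z; LEAD F0P3a-plan (g12) T11-70 (F0P2-ref1 (g9) r339: REL♯ is SIGN-BEARING — ★ `F0P3RelParityOfT5` reads `𝔠.sgnG ξ` through the laws — so the
aggregator's `relSharpOne_of_rung1` needs this W-twin, not an `Iff.rfl` transport); pen F0P2-p02 (g12) (author of the ★ original p843507).  THEOREMS ONLY; no def, no instance,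
no notation, no `sorry`; ADDITIVE (★ `F0P3RelParityOfRecord` untouched).  `--supports stmt-HodgeConjecture-24833`.
HONEST LABEL: HC_CM is proved only modulo the printed citations until rung 0 closes; this file is count-neutral support (plumbing + transports, no new mathematics).

* **`lawsV8_kitFamilyOfRecordW_of_rows 𝔇W h : F0P3InnerFormClassificationV8.KitFamily.Laws (kitFamilyOfRecordW 𝔇W)`** — the v8 family LAWS of the W family from the closer's
  fourteen per-frame rows AT THE W KIT (`h` = ★ (w2) `letters_of_specPkgV8W_cot`'s hypothesis VERBATIM; proof = ★ (w2) `lawsV8_kitFamilyOfRecordW_of` ∘ `laws₈_kitOfRecordW_of₄`).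
* **`relSharpOneMeasure_of_rowsW 𝔇W h`** := ★ `F0P3RelParityOfT5.relSharpGuardedOneMeasure_of_T5 (kitFamilyOfRecordW 𝔇W) (isPinned_kitFamilyOfRecordW 𝔇W)
  (lawsV8_kitFamilyOfRecordW_of_rows 𝔇W h)` — conclusion text BYTE-VERBATIM = ★ `relSharpOneMeasure_of_rows`'s = E2 ED. 4 `StubRelSharpParityOne` body, so the closer's
  `theorem relSharpOne_of_rung1 := relSharpOneMeasure_of_rowsW frameDataOfRung0W rows_of_rung0` keeps its TYPE (ws-sha16 59066fa85ffa4a7c; socket 27455 input BY NAME untouched).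
[cite: Rogawski1990, §14.6 Thm. 14.6.4 pp. 236–244; §13.1 Prop. 13.1.3 (d); §15.2 Prop. 15.2.1; §15.3 ¶1 p. 244] [cite: Rogawski1992, Thm. 1.2 p. 397]
-/

set_option autoImplicit false
set_option linter.dupNamespace false

noncomputable section

open NumberField IsDedekindDomain MeasureTheory
open Literature.NumberTheory.Rogawski1990 Literature.NumberTheory.GaloisRepresentations
open Literature.NumberTheory.Automorphic Literature.NumberTheory.Automorphic.UnitaryGroup
open Literature.NumberTheory.Automorphic.UnitaryGroup.CotangentForms
open Summit.HodgeConjecture.HodgeConjecture.Cruxes.H413.F0P3XiArchPacketOfRecord (JInfNoDegOne DsInfNoDegOne)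
open scoped Matrix ComplexOrder

namespace Summit.HodgeConjecture.HodgeConjecture.Cruxes.H413.F0P3KitOfRecordW

open Summit.HodgeConjecture.HodgeConjecture.Cruxes.H413.F0P3KitOfRecord

open Summit.HodgeConjecture.HodgeConjecture.Cruxes.H413.F0P3InnerFormClassificationV6 (Sockets Gp Places Cinf IsCot KcTrivial)

/-- **THE v8 FAMILY LAWS FROM THE CLOSER'S FOURTEEN ROWS** (`h` = ★ `letters_of_specPkgV8W_cot`'s hypothesis verbatim): ★ `lawsV8_kitFamilyOfRecordW_of` ∘ ★ `laws₈_kitOfRecordW_of₄`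
(with `Factorisation` from `FactorisationCls` + the package's `FactorisationPk`, ★ `factorisation_of_cls_of_pk`).  [cite: Rogawski1990, §14.6 Thm. 14.6.4 pp. 236–244; §14.2 p. 228] -/
theorem lawsV8_kitFamilyOfRecordW_of_rows
    (𝔇W : ∀ (L : Type) [Field L] [NumberField L] [IsCMField L] (ι : L →+* ℂ) (H : Matrix (Fin 3) (Fin 3) L) (T : GL (Fin 3) ℂ)
      (hT : (T : Matrix (Fin 3) (Fin 3) ℂ)ᴴ * H.map ι * (T : Matrix (Fin 3) (Fin 3) ℂ) = Literature.Geometry.ComplexHyperbolic.BallModel.J),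
      (∀ τ' : L →+* ℂ, InfinitePlace.mk τ' ≠ InfinitePlace.mk ι → (H.map τ').PosDef) →
      2 ≤ Module.finrank ℚ ↥(maximalRealSubfield L) →
      ∀ (μ : Measure (Gp L H).automorphicQuotient) [(Gp L H).IsAutomorphicMeasure μ] (μω : HeckeCharacter L) (_hμu : μω.IsUnitary),
      (∀ x : Literature.NumberTheory.GaloisRepresentations.ideleGroup ↥(maximalRealSubfield L),
        μω (AdeleRing.ideleBaseChange (↥(maximalRealSubfield L)) L x) = quadraticHeckeCharCM L x) → FrameDataW L H ι T hT μ)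
    (h : ∀ (L : Type) [Field L] [NumberField L] [IsCMField L] (ι : L →+* ℂ) (H : Matrix (Fin 3) (Fin 3) L) (T : GL (Fin 3) ℂ)
      (hT : (T : Matrix (Fin 3) (Fin 3) ℂ)ᴴ * H.map ι * (T : Matrix (Fin 3) (Fin 3) ℂ) = Literature.Geometry.ComplexHyperbolic.BallModel.J)
      (hdef : ∀ τ' : L →+* ℂ, InfinitePlace.mk τ' ≠ InfinitePlace.mk ι → (H.map τ').PosDef) (h2 : 2 ≤ Module.finrank ℚ ↥(maximalRealSubfield L))
      (μ : Measure (Gp L H).automorphicQuotient) [(Gp L H).IsAutomorphicMeasure μ] (μω : HeckeCharacter L) (hμu : μω.IsUnitary)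
      (hμω : ∀ x : Literature.NumberTheory.GaloisRepresentations.ideleGroup ↥(maximalRealSubfield L),
        μω (AdeleRing.ideleBaseChange (↥(maximalRealSubfield L)) L x) = quadraticHeckeCharCM L x),
      -- ONE level `S₀` per frame (v8, RULING (V44)); the witnessed package at `S₀` (K9β: `Classical.choose_spec`, unioned by `.mono`)
      ∃ S₀ : Finset (Places L),
      F0P3InnerFormClassificationV8.ClassificationKit.SpecPkg (kitFamilyOfRecordW 𝔇W L ι H T hT hdef h2 μ μω hμu hμω) S₀ ∧
      -- #1 (T1's head at the overridden kit, K9β §A), TF (class factorisation), #2, #6, #7, #8, #10, #15 (v8 text, GUARDED `IsCot P → KcTrivial P → …` — ★ `routing₈_kitOfRecord_of_cot`)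
      (kitFamilyOfRecordW 𝔇W L ι H T hT hdef h2 μ μω hμu hμω).TraceIdentity ∧
      F0P3InnerFormClassificationV8.ClassificationKit.FactorisationCls (kitFamilyOfRecordW 𝔇W L ι H T hT hdef h2 μ μω hμu hμω) S₀ ∧
      (kitFamilyOfRecordW 𝔇W L ι H T hT hdef h2 μ μω hμu hμω).SpectralSideGp ∧
      F0P3InnerFormClassificationV8.ClassificationKit.HatBounded (kitFamilyOfRecordW 𝔇W L ι H T hT hdef h2 μ μω hμu hμω) S₀ ∧
      F0P3InnerFormClassificationV8.ClassificationKit.UnrStarAlgebra (kitFamilyOfRecordW 𝔇W L ι H T hT hdef h2 μ μω hμu hμω) S₀ ∧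
      (kitFamilyOfRecordW 𝔇W L ι H T hT hdef h2 μ μω hμu hμω).LinIndepS ∧
      F0P3InnerFormClassificationV8.ClassificationKit.UnitaryPacket (kitFamilyOfRecordW 𝔇W L ι H T hT hdef h2 μ μω hμu hμω) S₀ ∧
      F0P3InnerFormClassificationV8.ClassificationKit.Routing (kitFamilyOfRecordW 𝔇W L ι H T hT hdef h2 μ μω hμu hμω) ∧
      -- the arch clauses on the family's `jInf dsInf` (R-22′) and the ξ-rows #20 #21 #23 (no #12 `FlathDet`, no «AFA»: RULINGS (V43)(V44))
      JInfNoDegOne (𝔇W L ι H T hT hdef h2 μ μω hμu hμω).jInf ∧ DsInfNoDegOne (𝔇W L ι H T hT hdef h2 μ μω hμu hμω).dsInf ∧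
      (kitFamilyOfRecordW 𝔇W L ι H T hT hdef h2 μ μω hμu hμω).XiFamilyFin μω hμu ∧
      (kitFamilyOfRecordW 𝔇W L ι H T hT hdef h2 μ μω hμu hμω).XiUnram ∧
      (kitFamilyOfRecordW 𝔇W L ι H T hT hdef h2 μ μω hμu hμω).EvpConvention) :
    F0P3InnerFormClassificationV8.KitFamily.Laws (kitFamilyOfRecordW 𝔇W) := by
  refine lawsV8_kitFamilyOfRecordW_of 𝔇W fun L _ _ _ ι H T hT hdef h2 μ _ μω hμu hμω => ?_
  obtain ⟨S₀, hpk, h1, hTF, h2', h6, h7, h8, h10, h15, hJ, hD, h20, h21, h23⟩ := h L ι H T hT hdef h2 μ μω hμu hμω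
  letI : MeasurableSpace (Gp L H).Adelic := borel _
  haveI : BorelSpace (Gp L H).Adelic := ⟨rfl⟩
  haveI := (𝔇W L ι H T hT hdef h2 μ μω hμu hμω).isFiniteMeasureOnCompacts_ν
  exact ⟨S₀, laws₈_kitOfRecordW_of₄ L H ι T hT μ _ _ _ μω hμu _ _ _ _ _ _ _ _ S₀ hdef h2 h1 h2'
    (F0P3InnerFormClassificationV8.ClassificationKit.factorisation_of_cls_of_pk _ hTF hpk.factorisationPk) hpk.matchingS hpk.transferS h6 h7 h8 h10
    hpk.aPacketSpectral hpk.localExpansion h15 hμω hJ hD h20 h21 h23⟩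

set_option synthInstance.maxHeartbeats 400000 in
set_option maxHeartbeats 400000 in
-- the conclusion is the REL♯ text (scoped budget as in ★ `F0P3RelParityOfT5`)
/-- **REL♯ AT ONE AUTOMORPHIC MEASURE, AT THE KIT FAMILY OF RECORD, FROM THE FOURTEEN ROWS** — the closer's one-token junction shape (`relSharpOneMeasure_of_rowsW frameDataOfRung0
rows_of_rung0`): ★ `relSharpGuardedOneMeasure_of_T5` at `kitFamilyOfRecordW 𝔇W`, pinned by ★ `isPinned_kitFamilyOfRecordW` (no hypothesis), laws by `lawsV8_kitFamilyOfRecordW_of_rows`.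
[cite: Rogawski1990, §14.6 Thm. 14.6.4 pp. 236–239; §13.1 Prop. 13.1.3 (d) p. 199; §15.2 Prop. 15.2.1 p. 244] -/
theorem relSharpOneMeasure_of_rowsW
    (𝔇W : ∀ (L : Type) [Field L] [NumberField L] [IsCMField L] (ι : L →+* ℂ) (H : Matrix (Fin 3) (Fin 3) L) (T : GL (Fin 3) ℂ)
      (hT : (T : Matrix (Fin 3) (Fin 3) ℂ)ᴴ * H.map ι * (T : Matrix (Fin 3) (Fin 3) ℂ) = Literature.Geometry.ComplexHyperbolic.BallModel.J),
      (∀ τ' : L →+* ℂ, InfinitePlace.mk τ' ≠ InfinitePlace.mk ι → (H.map τ').PosDef) →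
      2 ≤ Module.finrank ℚ ↥(maximalRealSubfield L) →
      ∀ (μ : Measure (Gp L H).automorphicQuotient) [(Gp L H).IsAutomorphicMeasure μ] (μω : HeckeCharacter L) (_hμu : μω.IsUnitary),
      (∀ x : Literature.NumberTheory.GaloisRepresentations.ideleGroup ↥(maximalRealSubfield L),
        μω (AdeleRing.ideleBaseChange (↥(maximalRealSubfield L)) L x) = quadraticHeckeCharCM L x) → FrameDataW L H ι T hT μ)
    (h : ∀ (L : Type) [Field L] [NumberField L] [IsCMField L] (ι : L →+* ℂ) (H : Matrix (Fin 3) (Fin 3) L) (T : GL (Fin 3) ℂ)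
      (hT : (T : Matrix (Fin 3) (Fin 3) ℂ)ᴴ * H.map ι * (T : Matrix (Fin 3) (Fin 3) ℂ) = Literature.Geometry.ComplexHyperbolic.BallModel.J)
      (hdef : ∀ τ' : L →+* ℂ, InfinitePlace.mk τ' ≠ InfinitePlace.mk ι → (H.map τ').PosDef) (h2 : 2 ≤ Module.finrank ℚ ↥(maximalRealSubfield L))
      (μ : Measure (Gp L H).automorphicQuotient) [(Gp L H).IsAutomorphicMeasure μ] (μω : HeckeCharacter L) (hμu : μω.IsUnitary)
      (hμω : ∀ x : Literature.NumberTheory.GaloisRepresentations.ideleGroup ↥(maximalRealSubfield L),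
        μω (AdeleRing.ideleBaseChange (↥(maximalRealSubfield L)) L x) = quadraticHeckeCharCM L x),
      -- ONE level `S₀` per frame (v8, RULING (V44)); the witnessed package at `S₀` (K9β: `Classical.choose_spec`, unioned by `.mono`)
      ∃ S₀ : Finset (Places L),
      F0P3InnerFormClassificationV8.ClassificationKit.SpecPkg (kitFamilyOfRecordW 𝔇W L ι H T hT hdef h2 μ μω hμu hμω) S₀ ∧
      -- #1 (T1's head at the overridden kit, K9β §A), TF (class factorisation), #2, #6, #7, #8, #10, #15 (v8 text, GUARDED `IsCot P → KcTrivial P → …` — ★ `routing₈_kitOfRecord_of_cot`)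
      (kitFamilyOfRecordW 𝔇W L ι H T hT hdef h2 μ μω hμu hμω).TraceIdentity ∧
      F0P3InnerFormClassificationV8.ClassificationKit.FactorisationCls (kitFamilyOfRecordW 𝔇W L ι H T hT hdef h2 μ μω hμu hμω) S₀ ∧
      (kitFamilyOfRecordW 𝔇W L ι H T hT hdef h2 μ μω hμu hμω).SpectralSideGp ∧
      F0P3InnerFormClassificationV8.ClassificationKit.HatBounded (kitFamilyOfRecordW 𝔇W L ι H T hT hdef h2 μ μω hμu hμω) S₀ ∧
      F0P3InnerFormClassificationV8.ClassificationKit.UnrStarAlgebra (kitFamilyOfRecordW 𝔇W L ι H T hT hdef h2 μ μω hμu hμω) S₀ ∧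
      (kitFamilyOfRecordW 𝔇W L ι H T hT hdef h2 μ μω hμu hμω).LinIndepS ∧
      F0P3InnerFormClassificationV8.ClassificationKit.UnitaryPacket (kitFamilyOfRecordW 𝔇W L ι H T hT hdef h2 μ μω hμu hμω) S₀ ∧
      F0P3InnerFormClassificationV8.ClassificationKit.Routing (kitFamilyOfRecordW 𝔇W L ι H T hT hdef h2 μ μω hμu hμω) ∧
      -- the arch clauses on the family's `jInf dsInf` (R-22′) and the ξ-rows #20 #21 #23 (no #12 `FlathDet`, no «AFA»: RULINGS (V43)(V44))
      JInfNoDegOne (𝔇W L ι H T hT hdef h2 μ μω hμu hμω).jInf ∧ DsInfNoDegOne (𝔇W L ι H T hT hdef h2 μ μω hμu hμω).dsInf ∧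
      (kitFamilyOfRecordW 𝔇W L ι H T hT hdef h2 μ μω hμu hμω).XiFamilyFin μω hμu ∧
      (kitFamilyOfRecordW 𝔇W L ι H T hT hdef h2 μ μω hμu hμω).XiUnram ∧
      (kitFamilyOfRecordW 𝔇W L ι H T hT hdef h2 μ μω hμu hμω).EvpConvention) :
    ∀ (L : Type) [Field L] [NumberField L] [IsCMField L] (ι : L →+* ℂ) (H : Matrix (Fin 3) (Fin 3) L) (T : GL (Fin 3) ℂ)
      (hT : (T : Matrix (Fin 3) (Fin 3) ℂ)ᴴ * H.map ι * (T : Matrix (Fin 3) (Fin 3) ℂ) = Literature.Geometry.ComplexHyperbolic.BallModel.J),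
      (∀ τ' : L →+* ℂ, InfinitePlace.mk τ' ≠ InfinitePlace.mk ι → (H.map τ').PosDef) → 2 ≤ Module.finrank ℚ ↥(maximalRealSubfield L) →
        ∀ (μA : Measure (adelicGroupData (↥(maximalRealSubfield L)) L (IsCMField.complexConj L) 3 H).automorphicQuotient)
          [(adelicGroupData (↥(maximalRealSubfield L)) L (IsCMField.complexConj L) 3 H).IsAutomorphicMeasure μA]
          (P P' : DiscreteAutomorphicRep (adelicGroupData (↥(maximalRealSubfield L)) L (IsCMField.complexConj L) 3 H) μA),
          (P.IsHolCotangentAt (cmArchSection L ι H T hT) (cmCompactFactor L ι H T hT) ∨ P.IsAntiholCotangentAt (cmArchSection L ι H T hT) (cmCompactFactor L ι H T hT)) →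
          (P'.IsHolCotangentAt (cmArchSection L ι H T hT) (cmCompactFactor L ι H T hT) ∨ P'.IsAntiholCotangentAt (cmArchSection L ι H T hT) (cmCompactFactor L ι H T hT)) →
          ∀ (μω : HeckeCharacter L) (hμu : μω.IsUnitary),
            (∀ x : Literature.NumberTheory.GaloisRepresentations.ideleGroup ↥(maximalRealSubfield L),
              μω (AdeleRing.ideleBaseChange (↥(maximalRealSubfield L)) L x) = quadraticHeckeCharCM L x) →
          ∀ (ξ : OneDimAutRepH L),
            MemXiFamily P (transpose_map_cmConjRingHom_eq_of_frame L ι H T hT) (isUnit_det_of_frame L ι H T hT) μω hμu ξ →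
            MemXiFamily P' (transpose_map_cmConjRingHom_eq_of_frame L ι H T hT) (isUnit_det_of_frame L ι H T hT) μω hμu ξ →
              Even ({v : HeightOneSpectrum (𝓞 ↥(maximalRealSubfield L)) | ¬ ((∃ c : IrrClass ((cmDatum L 3 H).Local v),
                  (IrrClass.comap (localPiEquiv L (IsCMField.complexConj L) 3 H v) c).IsConstituentOf
                      (P.finRep.smoothPart.toRepresentation.comp (inclPlace (↥(maximalRealSubfield L)) L (IsCMField.complexConj L) 3 H v)) ∧
                    c.IsSupercuspidal) ↔
                (∃ c : IrrClass ((cmDatum L 3 H).Local v),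
                  (IrrClass.comap (localPiEquiv L (IsCMField.complexConj L) 3 H v) c).IsConstituentOf
                      (P'.finRep.smoothPart.toRepresentation.comp (inclPlace (↥(maximalRealSubfield L)) L (IsCMField.complexConj L) 3 H v)) ∧
                    c.IsSupercuspidal))}.ncard) :=
  F0P3RelParityOfT5.relSharpGuardedOneMeasure_of_T5 (kitFamilyOfRecordW 𝔇W) (isPinned_kitFamilyOfRecordW 𝔇W) (lawsV8_kitFamilyOfRecordW_of_rows 𝔇W h)

end Summit.HodgeConjecture.HodgeConjecture.Cruxes.H413.F0P3KitOfRecordW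

end
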